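import Literature.NumberTheory.GaloisRepresentations.IdeleClassBarSRelativeLayers
import Literature.Algebra.Homology.RepCokernelCarrier
import Literature.Algebra.Homology.DiscreteRepLayerColimitGroupCohomology
import Literature.Algebra.Homology.DiscreteRepInternalHom
import Literature.Algebra.Homology.TateNakayamaInflationVanishingHom
import Literature.Algebra.Homology.CoinducedConjugation
import HarnessLib

/-!
# Layers of `Hom(N, C̄_S)` for a `G_S`-lattice `N`: at a layer `E ⊆ K_S` whose group `V̄_E = Gal(K_S/E)` acts trivially on `N`,
# `(Hom(N, C̄_S))^{V̄_E} ≅ Hom(N_E, C_S(E))` as `Gal(E/K)`-modules, and door-c4's transitions are `F ↦ Inf ∘ F`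
# (Milne ADT I, proof of Lemma 1.9: `Extʳ_G(M, C) = lim→ Hʳ(G/U, Hom(M, C^U))`, for `(G_S, C_S)`)

Topic `NumberTheory/GaloisRepresentations`; namespace `Literature.NumberTheory.GaloisRepresentations.IdeleClassBar`.  Definitions with
bodies (PLUMBING: the descended coefficient action, the embedding `C_S(E) ↪ C̄_S`, the layer module isomorphism and the induced
isomorphism on group cohomology, the `Hom`-transitions) and theorems; no named fact, no instance, no notation, no `sorry`.  This is
the `C̄_S`-twin of door-c6 g15's `GalLayerSystemIhomLayers.lean` (there: `Γ_F`, the all-places class module `C̄ = lim→ C_E`), written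
over bsd-line-x1-p1-w3's `IdeleClassBarSLayers.lean` / `IdeleClassBarSRelativeLayers.lean` (`layerSubgroupS S E = V̄_E ≤ G_S`,
`quotLayerSEquiv : G_S ⧸ V̄_E ≃* Gal(E/K)`, `restrictHomS`, `layerRepS S E = C̄_S^{V̄_E}`, `toLayerS`, `layerSModuleEquiv : C̄_S^{V̄_E} ≃ₗ[ℤ] C_S(E)`), door-c4's `DiscreteRepInternalHom`
(`DiscreteRep.ihomObj N P = Hom_ℤ(N, P)` with the conjugation action, an object of `C_Γ` for `N` finitely generated) and door-c6's
`TateNakayamaInflationVanishingHom` (`ihomTransition`: `F ↦ ι ∘ F ∘ e`).  Cell `bsd-eis`, background lane «PT-Ш-S-TC», brick D2-TN,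
field (10) `hN` of `DiscreteRep.tateDualityHypothesesAt_of_coprime` for `C = classBarSD K S` ("every class of `Extʳ_{C_{G_S}}(N, C̄_S)`,
`r ≥ 3`, `N` a lattice, is killed by an integer prime to `p`"): by door-c4's `extIhomAddEquivOfProjective` (Harari 16.16 (b)) that is
a statement about `Extʳ(ℤ, Hom(N, C̄_S))`, read on the layers of `Hom(N, C̄_S)` computed HERE; the killing of the layer classes
(Tate–Nakayama with `Hom`-coefficients, bsd-line-x1-p1-w4's `IsClassModule.map_ihom_eq_zero_of_nsmul_eq_zero`) and the colimit are the
sequel.  HONEST FRAMING: Galois-module bookkeeping; no arithmetic statement and no case of BSD is proved here.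

## What is formalised (`K` a number field, `S : Finset`, `G_S = GaloisGroupUnramifiedOutside K ↑S`, `ρN : G_S → GL(V)`, `V` f.g.)

* §1 `TrivialOnS S ρN E` (`V̄_E` acts trivially), `coeffRepS` / `coeffS` (the descended `Gal(E/K)`-action, `coeffRepS_restrictHomS`:
  `σ|_E ↦ ρN [σ]`, `coeffRepS_resHom`).
* §2 **`ofClassModUnitsS S hE : C_S(E) →+ C̄_S`** (`y ↦` the vector of `layerSModuleEquiv⁻¹ y`; `ofClassModUnitsS_π`: `π x ↦ [x]`,
  injective, `V̄_E`-fixed values, equivariance `[g] • of y = of (g|_E • y)`).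
* §3 the layer objects `ihomLayerRepS` of `Hom(N, C̄_S)`, `toCoeffHomS` / `ofCoeffHomS`, **`ihomLayerEquivS :
  (Hom(N, C̄_S))^{V̄_E} ≃ₗ[ℤ] Hom_ℤ(V, C_S(E))`** (+ `_ρ_mk`), **`ihomLayerCohomologyIsoS hE hT n :
  Hⁿ(G_S ⧸ V̄_E, (Hom(N, C̄_S))^{V̄_E}) ≅ Hⁿ(Gal(E/K), Hom(N_E, C_S(E)))`**.
* §4 transitions (`E ≤ M ⊆ K_S`): `ihomBaseRepHomS` (`F ↦ Inf_{M/E} ∘ F` over `res`, with bsd-line-x1-p1-w4's `classModUnitsInflHom`),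
  `ihomInfS`, `ihomLayerEquivS_invariantsStepIncl`, **`stepG_comp_ihomLayerCohomologyIsoS`** / `ihomLayerCohomologyIsoS_stepG`.

## References
* J. S. Milne, *Arithmetic Duality Theorems* (2nd ed. 2006), I §1, Lemma 1.9 (proof). [MilneADT2006]
* D. Harari, *Galois Cohomology and Class Field Theory* (2020), §16.2 Def. 16.10–16.11, Prop. 16.16 (b); §16.3 Lemma 16.20; §17.1.
  [Harari2020]
* J. Neukirch, A. Schmidt, K. Wingberg, *Cohomology of Number Fields*, 2nd ed. (2008), VIII §3 (8.3.8)–(8.3.9). [NeukirchSchmidtWingberg2008]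
* J.-P. Serre, *Galois Cohomology*, Springer (1997), I §2.2 Proposition 8. [SerreGaloisCohomology1997]
-/

noncomputable section

open NumberField IsDedekindDomain CategoryTheory CategoryTheory.Limits groupCohomology
open Field (absoluteGaloisGroup)
open Literature.Algebra.Homology Literature.NumberTheory.Automorphic
open Literature.NumberTheory.GaloisRepresentations.LocalWeilDatum (galFixing)

namespace Literature.NumberTheory.GaloisRepresentations

namespace IdeleClassBar

universe u

variable {K : Type} [Field K] [NumberField K] (S : Finset (HeightOneSpectrum (𝓞 K)))

/-! ## §1. The coefficient lattice at a layer acting trivially -/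

section Coeff

variable {V : Type} [AddCommGroup V]
  (ρN : Representation ℤ (GaloisGroupUnramifiedOutside K (↑S : Set (HeightOneSpectrum (𝓞 K)))) V)

omit [NumberField K] in
/-- `V̄_E = Gal(K_S/E)` acts trivially on `V` through `ρN`. [cite: MilneADT2006, I Lemma 1.9] -/
def TrivialOnS (E : GalLayer K) : Prop :=
  ∀ g ∈ (layerSubgroupS S E : Subgroup (GaloisGroupUnramifiedOutside K (↑S : Set (HeightOneSpectrum (𝓞 K))))), ∀ x : V, ρN g x = x

variable {ρN} in
omit [NumberField K] in
/-- `TrivialOnS` is monotone in the layer. [cite: MilneADT2006, I Lemma 1.9] -/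
theorem TrivialOnS.mono {E E' : GalLayer K} (h : E ≤ E') (hE : TrivialOnS S ρN E) : TrivialOnS S ρN E' :=
  fun g hg x => hE g (layerSubgroupS_anti S h hg) x

variable {ρN} in
omit [NumberField K] in
/-- `V̄_E ≤ ker ρN` under `TrivialOnS`. [cite: MilneADT2006, I Lemma 1.9] -/
theorem TrivialOnS.le_ker {E : GalLayer K} (hE : TrivialOnS S ρN E) :
    (layerSubgroupS S E : Subgroup (GaloisGroupUnramifiedOutside K (↑S : Set (HeightOneSpectrum (𝓞 K))))) ≤ ρN.ker :=
  fun g hg => LinearMap.ext (hE g hg)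

variable {E : GalLayer K} (hE : ramificationSubgroup K (↑S : Set (HeightOneSpectrum (𝓞 K))) ≤ galFixing K E.1)

/-- **The descended action of `Gal(E/K)` on `V`** (`g|_E ↦ ρN g`, well defined when `V̄_E` acts trivially):
`QuotientGroup.lift` along `quotLayerSEquiv : G_S ⧸ V̄_E ≃* Gal(E/K)`. [cite: MilneADT2006, I Lemma 1.9] -/
def coeffRepS (hT : TrivialOnS S ρN E) : Representation ℤ (E.1 ≃ₐ[K] E.1) V :=
  (QuotientGroup.lift _ ρN hT.le_ker).comp (quotLayerSEquiv S hE).symm.toMonoidHom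

/-- `coeffRepS (g|_E) = ρN g`. [cite: MilneADT2006, I Lemma 1.9] -/
@[simp]
theorem coeffRepS_restrictHomS (hT : TrivialOnS S ρN E)
    (g : GaloisGroupUnramifiedOutside K (↑S : Set (HeightOneSpectrum (𝓞 K)))) :
    coeffRepS S ρN hE hT (restrictHomS S hE g) = ρN g := by
  have h1 : (quotLayerSEquiv S hE).symm (restrictHomS S hE g) = QuotientGroup.mk g :=
    (MulEquiv.symm_apply_eq _).2 rfl
  rw [coeffRepS, MonoidHom.comp_apply, MulEquiv.coe_toMonoidHom, h1, QuotientGroup.lift_mk]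

/-- `coeffRepS` at `E ≤ M` is `coeffRepS` at `E` after `res : Gal(M/K) → Gal(E/K)`. [cite: MilneADT2006, I Lemma 1.9] -/
theorem coeffRepS_resHom {M : GalLayer K} (h : E ≤ M)
    (hM : ramificationSubgroup K (↑S : Set (HeightOneSpectrum (𝓞 K))) ≤ galFixing K M.1)
    (hTE : TrivialOnS S ρN E) (hTM : TrivialOnS S ρN M) (τ : M.1 ≃ₐ[K] M.1) :
    coeffRepS S ρN hE hTE (GalLayer.resHom h τ) = coeffRepS S ρN hM hTM τ := by
  have hτ := ((quotLayerSEquiv S hM).surjective.comp (QuotientGroup.mk'_surjective _)) τ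
  obtain ⟨g, rfl⟩ := hτ
  change coeffRepS S ρN hE hTE (GalLayer.resHom h (restrictHomS S hM g)) = coeffRepS S ρN hM hTM (restrictHomS S hM g)
  rw [resHom_restrictHomS S h hE hM, coeffRepS_restrictHomS, coeffRepS_restrictHomS]

/-- **The coefficient lattice `N_E`**: `V` as a representation of `Gal(E/K)`. [cite: MilneADT2006, I Lemma 1.9] -/
abbrev coeffS (hT : TrivialOnS S ρN E) : Rep ℤ (E.1 ≃ₐ[K] E.1) := Rep.of (coeffRepS S ρN hE hT)

end Coeff

/-! ## §2. `C_S(E) ↪ C̄_S`: the vectors of the layer `C̄_S^{V̄_E} ≃ C_S(E)` -/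

section OfClassModUnits

variable {E : GalLayer K} (hE : ramificationSubgroup K (↑S : Set (HeightOneSpectrum (𝓞 K))) ≤ galFixing K E.1)

/-- **`C_S(E) → C̄_S`**, `y ↦` the underlying vector of `layerSModuleEquiv⁻¹ y ∈ C̄_S^{V̄_E}` (so `π x ↦ [x]`, the image of `x ∈ C_E`).
[cite: NeukirchSchmidtWingberg2008, VIII §3 (8.3.8)][cite: Harari2020, §17.1 Thm. 17.2] -/
def ofClassModUnitsS :
    (haveI := E.numberField; (IdeleCohomology.classModUnitsRep K E.1 S).V) →+ (classBarSRep K S).V :=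
  haveI := E.numberField
  letI := (layerRepS S E).hV2
  letI := (IdeleCohomology.classModUnitsRep K E.1 S).hV2
  AddMonoidHom.mk' (fun y => (((layerSModuleEquiv S hE).symm y : (layerRepS S E).V).1 : (classBarSRep K S).V))
    fun y z => by rw [map_add]; rfl

/-- Formula: `ofClassModUnitsS y` is the vector of `layerSModuleEquiv⁻¹ y`. [cite: NeukirchSchmidtWingberg2008, VIII §3 (8.3.8)] -/
theorem ofClassModUnitsS_apply (y : haveI := E.numberField; (IdeleCohomology.classModUnitsRep K E.1 S).V) :
    ofClassModUnitsS S hE y =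
      (haveI := E.numberField; letI := (layerRepS S E).hV2; letI := (IdeleCohomology.classModUnitsRep K E.1 S).hV2;
        (((layerSModuleEquiv S hE).symm y : (layerRepS S E).V).1 : (classBarSRep K S).V)) := rfl

/-- **`ofClassModUnitsS (π x) = [x]`** (`= ofLayerS x`). [cite: NeukirchSchmidtWingberg2008, VIII §3 (8.3.8)] -/
theorem ofClassModUnitsS_π (x : layerClass K E) :
    ofClassModUnitsS S hE (haveI := E.numberField; (cokernel.π (IdeleCohomology.unitsOffToClass (F := K) (E := E.1) S)).hom x) =
      ofLayerS S hE x := by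
  haveI := E.numberField
  letI := (layerRepS S E).hV2
  letI := (IdeleCohomology.classModUnitsRep K E.1 S).hV2
  have h1 : (layerSModuleEquiv S hE).symm ((cokernel.π (IdeleCohomology.unitsOffToClass (F := K) (E := E.1) S)).hom x) =
      toLayerS S hE x :=
    (LinearEquiv.symm_apply_eq _).2 (layerSModuleEquiv_toLayerS S hE x).symm
  rw [ofClassModUnitsS_apply, h1, coe_toLayerS]

/-- `ofClassModUnitsS` is injective. [cite: NeukirchSchmidtWingberg2008, VIII §3 (8.3.8)] -/
theorem ofClassModUnitsS_injective : Function.Injective (ofClassModUnitsS S hE) := by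
  haveI := E.numberField
  letI := (layerRepS S E).hV2
  letI := (IdeleCohomology.classModUnitsRep K E.1 S).hV2
  intro y z h
  exact (layerSModuleEquiv S hE).symm.injective (Subtype.ext h)

/-- The values of `ofClassModUnitsS` are fixed by `V̄_E`. [cite: NeukirchSchmidtWingberg2008, VIII §3 (8.3.7)] -/
theorem classBarSRep_ρ_ofClassModUnitsS_of_mem {g : GaloisGroupUnramifiedOutside K (↑S : Set (HeightOneSpectrum (𝓞 K)))}
    (hg : g ∈ (layerSubgroupS S E : Subgroup (GaloisGroupUnramifiedOutside K (↑S : Set (HeightOneSpectrum (𝓞 K))))))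
    (y : haveI := E.numberField; (IdeleCohomology.classModUnitsRep K E.1 S).V) :
    (classBarSRep K S).ρ g (ofClassModUnitsS S hE y) = ofClassModUnitsS S hE y := by
  haveI := E.numberField
  letI := (layerRepS S E).hV2
  letI := (IdeleCohomology.classModUnitsRep K E.1 S).hV2
  exact ((layerSModuleEquiv S hE).symm y).2 ⟨g, hg⟩

/-- **Equivariance**: `g • ofClassModUnitsS y = ofClassModUnitsS (g|_E • y)` for `g ∈ G_S`.
[cite: NeukirchSchmidtWingberg2008, VIII §3 (8.3.8)] -/
theorem classBarSRep_ρ_ofClassModUnitsS (g : GaloisGroupUnramifiedOutside K (↑S : Set (HeightOneSpectrum (𝓞 K))))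
    (y : haveI := E.numberField; (IdeleCohomology.classModUnitsRep K E.1 S).V) :
    (classBarSRep K S).ρ g (ofClassModUnitsS S hE y) =
      ofClassModUnitsS S hE (haveI := E.numberField; (IdeleCohomology.classModUnitsRep K E.1 S).ρ (restrictHomS S hE g) y) := by
  haveI := E.numberField
  letI := (layerRepS S E).hV2
  letI := (IdeleCohomology.classModUnitsRep K E.1 S).hV2
  -- `layerSModuleEquiv ([g] • z) = g|_E • layerSModuleEquiv z` at `z = layerSModuleEquiv⁻¹ y`
  have hc := LinearMap.congr_fun (layerSModuleEquiv_comm S hE (QuotientGroup.mk g)) ((layerSModuleEquiv S hE).symm y)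
  simp only [LinearMap.coe_comp, Function.comp_apply, LinearEquiv.coe_coe, LinearEquiv.apply_symm_apply] at hc
  have hc' : (layerSModuleEquiv S hE).symm ((IdeleCohomology.classModUnitsRep K E.1 S).ρ (restrictHomS S hE g) y) =
      (layerRepS S E).ρ (QuotientGroup.mk g) ((layerSModuleEquiv S hE).symm y) := by
    rw [LinearEquiv.symm_apply_eq]
    exact hc.symm
  rw [ofClassModUnitsS_apply, ofClassModUnitsS_apply, hc']
  rfl

/-- **Every `V̄_E`-invariant vector of `C̄_S` is `ofClassModUnitsS y`** (`toLayerS` is onto).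
[cite: NeukirchSchmidtWingberg2008, VIII §3 (8.3.7)][cite: Harari2020, Prop. 15.40 (b)] -/
theorem exists_ofClassModUnitsS_eq (z : (classBarSRep K S).V)
    (hz : z ∈ Representation.invariants ((classBarSRep K S).ρ.comp
      (layerSubgroupS S E : Subgroup (GaloisGroupUnramifiedOutside K (↑S : Set (HeightOneSpectrum (𝓞 K))))).subtype)) :
    ∃ y : (haveI := E.numberField; (IdeleCohomology.classModUnitsRep K E.1 S).V), ofClassModUnitsS S hE y = z := by
  haveI := E.numberField
  have h := toLayerS_surjective S hE ⟨z, hz⟩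
  obtain ⟨x, hx⟩ := h
  refine ⟨(cokernel.π (IdeleCohomology.unitsOffToClass (F := K) (E := E.1) S)).hom x, ?_⟩
  rw [ofClassModUnitsS_π]
  exact congrArg Subtype.val hx

end OfClassModUnits

/-! ## §3. The layer `(Hom(N, C̄_S))^{V̄_E} ≅ Hom(N_E, C_S(E))` -/

section IhomLayer

variable {V : Type} [AddCommGroup V]
  (ρN : Representation ℤ (GaloisGroupUnramifiedOutside K (↑S : Set (HeightOneSpectrum (𝓞 K)))) V)
  (hρN : DiscreteRep.IsDiscrete (Rep.of ρN)) [Module.Finite ℤ V]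

omit [NumberField K] in
/-- The lattice as an object of `C_{G_S}`. [cite: Harari2020, §16.2 Definition 16.10] -/
abbrev latticeDS : DiscreteRepCat ℤ (GaloisGroupUnramifiedOutside K (↑S : Set (HeightOneSpectrum (𝓞 K)))) :=
  DiscreteRep.mk (Rep.of ρN) hρN

/-- **Door-c4's layer object of `Hom(N, C̄_S)` at `V̄_E`** (`(invariantsQuotFunctor ℤ V̄_E).obj (ihomObj N C̄_S)`; an abbreviation,
so that `stepG` applies verbatim). [cite: SerreGaloisCohomology1997, I §2.2 Proposition 8] -/
abbrev ihomLayerRepS (E : GalLayer K) :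
    Rep ℤ (GaloisGroupUnramifiedOutside K (↑S : Set (HeightOneSpectrum (𝓞 K))) ⧸
      (layerSubgroupS S E : Subgroup (GaloisGroupUnramifiedOutside K (↑S : Set (HeightOneSpectrum (𝓞 K)))))) :=
  (DiscreteRep.invariantsQuotFunctor ℤ
    (layerSubgroupS S E : Subgroup (GaloisGroupUnramifiedOutside K (↑S : Set (HeightOneSpectrum (𝓞 K)))))).obj
    (DiscreteRep.ihomObj (latticeDS S ρN hρN) (classBarSD K S))

/-- The underlying linear map `V → C̄_S` of a vector of the layer. [cite: MilneADT2006, I Lemma 1.9] -/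
def ihomLayerFunS {E : GalLayer K} (Φ : (ihomLayerRepS S ρN hρN E).V) : V →ₗ[ℤ] (classBarSRep K S).V := Φ.1

variable {E : GalLayer K} (hE : ramificationSubgroup K (↑S : Set (HeightOneSpectrum (𝓞 K))) ≤ galFixing K E.1)
  (hT : TrivialOnS S ρN E)

include hT in
/-- The values of a `V̄_E`-invariant map `Φ : V → C̄_S` are `V̄_E`-invariant when `V̄_E` acts trivially on `V`.
[cite: MilneADT2006, I Lemma 1.9] -/
theorem apply_mem_invariantsS (Φ : (ihomLayerRepS S ρN hρN E).V) (x : V) :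
    ihomLayerFunS S ρN hρN Φ x ∈ Representation.invariants ((classBarSRep K S).ρ.comp
      (layerSubgroupS S E : Subgroup (GaloisGroupUnramifiedOutside K (↑S : Set (HeightOneSpectrum (𝓞 K))))).subtype) := fun u => by
  have h := LinearMap.congr_fun (Φ.2 u) (ρN (u : GaloisGroupUnramifiedOutside K (↑S : Set (HeightOneSpectrum (𝓞 K)))) x)
  change (classBarSRep K S).ρ (u : GaloisGroupUnramifiedOutside K (↑S : Set (HeightOneSpectrum (𝓞 K))))
      (ihomLayerFunS S ρN hρN Φ (ρN (u : GaloisGroupUnramifiedOutside K (↑S : Set (HeightOneSpectrum (𝓞 K))))⁻¹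
        (ρN (u : GaloisGroupUnramifiedOutside K (↑S : Set (HeightOneSpectrum (𝓞 K)))) x))) =
    ihomLayerFunS S ρN hρN Φ (ρN (u : GaloisGroupUnramifiedOutside K (↑S : Set (HeightOneSpectrum (𝓞 K)))) x) at h
  rw [← Module.End.mul_apply, ← map_mul, inv_mul_cancel, map_one, Module.End.one_apply, hT _ u.2 x] at h
  exact h

include hE hT in
/-- A `V̄_E`-invariant map `V → C̄_S` as a map `V → C̄_S^{V̄_E} ≃ C_S(E)`. [cite: MilneADT2006, I Lemma 1.9] -/
def toCoeffHomS (Φ : (ihomLayerRepS S ρN hρN E).V) :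
    letI := (haveI := E.numberField; IdeleCohomology.classModUnitsRep K E.1 S).hV2
    V →ₗ[ℤ] (haveI := E.numberField; (IdeleCohomology.classModUnitsRep K E.1 S).V) :=
  haveI := E.numberField
  letI := (layerRepS S E).hV2
  letI := (IdeleCohomology.classModUnitsRep K E.1 S).hV2
  (layerSModuleEquiv S hE).toLinearMap ∘ₗ
    LinearMap.codRestrict _ (ihomLayerFunS S ρN hρN Φ) (apply_mem_invariantsS S ρN hρN hT Φ)

/-- Formula: `ofClassModUnitsS (toCoeffHomS Φ x) = Φ x` in `C̄_S`. [cite: MilneADT2006, I Lemma 1.9] -/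
theorem ofClassModUnitsS_toCoeffHomS_apply (Φ : (ihomLayerRepS S ρN hρN E).V) (x : V) :
    ofClassModUnitsS S hE (toCoeffHomS S ρN hρN hE hT Φ x) = ihomLayerFunS S ρN hρN Φ x := by
  haveI := E.numberField
  letI := (layerRepS S E).hV2
  letI := (IdeleCohomology.classModUnitsRep K E.1 S).hV2
  rw [ofClassModUnitsS_apply]
  change (((layerSModuleEquiv S hE).symm ((layerSModuleEquiv S hE)
    (LinearMap.codRestrict _ (ihomLayerFunS S ρN hρN Φ) (apply_mem_invariantsS S ρN hρN hT Φ) x)) : (layerRepS S E).V).1 :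
      (classBarSRep K S).V) = _
  rw [LinearEquiv.symm_apply_apply]
  rfl

include hT in
/-- The lift `V → C̄_S` of a map `f : V → C_S(E)` (`x ↦ of (f x)`) is `V̄_E`-invariant for the conjugation action.
[cite: MilneADT2006, I Lemma 1.9] -/
theorem ofClassModUnitsS_comp_mem_invariants
    (f : letI := (haveI := E.numberField; IdeleCohomology.classModUnitsRep K E.1 S).hV2
      V →ₗ[ℤ] (haveI := E.numberField; (IdeleCohomology.classModUnitsRep K E.1 S).V)) :
    ((ofClassModUnitsS S hE).toIntLinearMap ∘ₗ
        (letI := (haveI := E.numberField; IdeleCohomology.classModUnitsRep K E.1 S).hV2; f.toAddMonoidHom.toIntLinearMap)) ∈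
      Representation.invariants
      ((DiscreteRep.ihomObj (latticeDS S ρN hρN) (classBarSD K S)).obj.ρ.comp
        (layerSubgroupS S E : Subgroup (GaloisGroupUnramifiedOutside K (↑S : Set (HeightOneSpectrum (𝓞 K))))).subtype) := fun u => by
  refine LinearMap.ext fun x => ?_
  change (classBarSRep K S).ρ (u : GaloisGroupUnramifiedOutside K (↑S : Set (HeightOneSpectrum (𝓞 K))))
      (ofClassModUnitsS S hE (f (ρN (u : GaloisGroupUnramifiedOutside K (↑S : Set (HeightOneSpectrum (𝓞 K))))⁻¹ x))) =
    ofClassModUnitsS S hE (f x)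
  rw [classBarSRep_ρ_ofClassModUnitsS_of_mem S hE u.2, hT _ (inv_mem u.2) x]

include hE hT in
/-- The inverse: `f ↦ (x ↦ of (f x))`. [cite: MilneADT2006, I Lemma 1.9] -/
def ofCoeffHomS
    (f : letI := (haveI := E.numberField; IdeleCohomology.classModUnitsRep K E.1 S).hV2
      V →ₗ[ℤ] (haveI := E.numberField; (IdeleCohomology.classModUnitsRep K E.1 S).V)) :
    (ihomLayerRepS S ρN hρN E).V :=
  ⟨(ofClassModUnitsS S hE).toIntLinearMap ∘ₗ
      (letI := (haveI := E.numberField; IdeleCohomology.classModUnitsRep K E.1 S).hV2; f.toAddMonoidHom.toIntLinearMap),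
    ofClassModUnitsS_comp_mem_invariants S ρN hρN hE hT f⟩

/-- Formula. [cite: MilneADT2006, I Lemma 1.9] -/
theorem ihomLayerFunS_ofCoeffHomS_apply
    (f : letI := (haveI := E.numberField; IdeleCohomology.classModUnitsRep K E.1 S).hV2
      V →ₗ[ℤ] (haveI := E.numberField; (IdeleCohomology.classModUnitsRep K E.1 S).V)) (x : V) :
    ihomLayerFunS S ρN hρN (ofCoeffHomS S ρN hρN hE hT f) x = ofClassModUnitsS S hE (f x) := rfl

/-- `toCoeffHomS (ofCoeffHomS f) = f`. [cite: MilneADT2006, I Lemma 1.9] -/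
theorem toCoeffHomS_ofCoeffHomS
    (f : letI := (haveI := E.numberField; IdeleCohomology.classModUnitsRep K E.1 S).hV2
      V →ₗ[ℤ] (haveI := E.numberField; (IdeleCohomology.classModUnitsRep K E.1 S).V)) :
    toCoeffHomS S ρN hρN hE hT (ofCoeffHomS S ρN hρN hE hT f) = f := by
  letI := (haveI := E.numberField; IdeleCohomology.classModUnitsRep K E.1 S).hV2
  refine LinearMap.ext fun x => ofClassModUnitsS_injective S hE ?_
  rw [ofClassModUnitsS_toCoeffHomS_apply, ihomLayerFunS_ofCoeffHomS_apply]

/-- `ofCoeffHomS (toCoeffHomS Φ) = Φ`. [cite: MilneADT2006, I Lemma 1.9] -/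
theorem ofCoeffHomS_toCoeffHomS (Φ : (ihomLayerRepS S ρN hρN E).V) :
    ofCoeffHomS S ρN hρN hE hT (toCoeffHomS S ρN hρN hE hT Φ) = Φ := by
  refine Subtype.ext (LinearMap.ext fun x => ?_)
  exact (ihomLayerFunS_ofCoeffHomS_apply S ρN hρN hE hT _ x).trans (ofClassModUnitsS_toCoeffHomS_apply S ρN hρN hE hT Φ x)

/-- The layer module as an additive equivalence `(Hom(N, C̄_S))^{V̄_E} ≃+ Hom_ℤ(V, C_S(E))`. [cite: MilneADT2006, I Lemma 1.9] -/
def ihomLayerAddEquivS :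
    letI := (haveI := E.numberField; IdeleCohomology.classModUnitsRep K E.1 S).hV2
    (ihomLayerRepS S ρN hρN E).V ≃+ (V →ₗ[ℤ] (haveI := E.numberField; (IdeleCohomology.classModUnitsRep K E.1 S).V)) :=
  haveI := E.numberField
  letI := (IdeleCohomology.classModUnitsRep K E.1 S).hV2
  { toFun := toCoeffHomS S ρN hρN hE hT
    map_add' := fun Φ Ψ => LinearMap.ext fun x => ofClassModUnitsS_injective S hE (by
      rw [LinearMap.add_apply, map_add, ofClassModUnitsS_toCoeffHomS_apply, ofClassModUnitsS_toCoeffHomS_apply,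
        ofClassModUnitsS_toCoeffHomS_apply]
      rfl)
    invFun := ofCoeffHomS S ρN hρN hE hT
    left_inv := ofCoeffHomS_toCoeffHomS S ρN hρN hE hT
    right_inv := toCoeffHomS_ofCoeffHomS S ρN hρN hE hT }

/-- Formula. [cite: MilneADT2006, I Lemma 1.9] -/
theorem ihomLayerAddEquivS_apply (Φ : (ihomLayerRepS S ρN hρN E).V) :
    ihomLayerAddEquivS S ρN hρN hE hT Φ = toCoeffHomS S ρN hρN hE hT Φ := rfl

/-- **The layer module: `(Hom(N, C̄_S))^{V̄_E} ≃ₗ[ℤ] Hom_ℤ(V, C_S(E))`** (the codomain written as the module of `Hom(N_E, C_S(E))` =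
Mathlib `Rep.ihom`, so that `groupCohomology.mapIso` applies verbatim; any additive equivalence is `ℤ`-linear,
`Int.cast_smul_eq_zsmul`). [cite: MilneADT2006, I Lemma 1.9][cite: Harari2020, §16.2 Definition 16.10] -/
def ihomLayerEquivS :
    letI := (ihomLayerRepS S ρN hρN E).hV2
    letI := (haveI := E.numberField; (Rep.ihom (coeffS S ρN hE hT)).obj (IdeleCohomology.classModUnitsRep K E.1 S)).hV2
    (ihomLayerRepS S ρN hρN E).V ≃ₗ[ℤ]
      (haveI := E.numberField; ((Rep.ihom (coeffS S ρN hE hT)).obj (IdeleCohomology.classModUnitsRep K E.1 S)).V) := by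
  haveI := E.numberField
  letI := (ihomLayerRepS S ρN hρN E).hV2
  letI := ((Rep.ihom (coeffS S ρN hE hT)).obj (IdeleCohomology.classModUnitsRep K E.1 S)).hV2
  letI := (IdeleCohomology.classModUnitsRep K E.1 S).hV2
  exact
    { ihomLayerAddEquivS S ρN hρN hE hT with
      map_smul' := fun c Φ => by
        simp only [AddEquiv.toFun_eq_coe, RingHom.id_apply]
        exact (congrArg (ihomLayerAddEquivS S ρN hρN hE hT) (Int.cast_smul_eq_zsmul ℤ c Φ)).trans
          ((map_zsmul (ihomLayerAddEquivS S ρN hρN hE hT) c Φ).trans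
            (Int.cast_smul_eq_zsmul
              (M := ((Rep.ihom (coeffS S ρN hE hT)).obj (IdeleCohomology.classModUnitsRep K E.1 S)).V) ℤ c
              (ihomLayerAddEquivS S ρN hρN hE hT Φ)).symm) }

/-- Formula. [cite: MilneADT2006, I Lemma 1.9] -/
theorem ihomLayerEquivS_apply (Φ : (ihomLayerRepS S ρN hρN E).V) :
    ihomLayerEquivS S ρN hρN hE hT Φ = toCoeffHomS S ρN hρN hE hT Φ := rfl

set_option maxHeartbeats 800000 in
-- the rewrites move through the `ℤ`-instance paths of `Hom_ℤ(V, C_S(E))` and of the layer object (slow unification)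
/-- **Equivariance, pointwise**: `ihomLayerEquivS ([g] • Φ) = g|_E • ihomLayerEquivS Φ` for the conjugation actions
(`[g] • Φ = g ∘ Φ ∘ ρN(g)⁻¹`; `τ • f = C_S(E).ρ τ ∘ f ∘ coeffRepS τ⁻¹`). [cite: Harari2020, §16.2 Definition 16.10] -/
theorem ihomLayerEquivS_ρ_mk (g : GaloisGroupUnramifiedOutside K (↑S : Set (HeightOneSpectrum (𝓞 K))))
    (Φ : (ihomLayerRepS S ρN hρN E).V) :
    haveI := E.numberField; letI := (IdeleCohomology.classModUnitsRep K E.1 S).hV2;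
    letI := (ihomLayerRepS S ρN hρN E).hV2;
    letI := ((Rep.ihom (coeffS S ρN hE hT)).obj (IdeleCohomology.classModUnitsRep K E.1 S)).hV2;
    ihomLayerEquivS S ρN hρN hE hT ((ihomLayerRepS S ρN hρN E).ρ (QuotientGroup.mk g) Φ) =
      (IdeleCohomology.classModUnitsRep K E.1 S).ρ (restrictHomS S hE g) ∘ₗ ihomLayerEquivS S ρN hρN hE hT Φ ∘ₗ
        coeffRepS S ρN hE hT (restrictHomS S hE g)⁻¹ := by
  haveI := E.numberField
  letI := (IdeleCohomology.classModUnitsRep K E.1 S).hV2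
  letI := (ihomLayerRepS S ρN hρN E).hV2
  letI := ((Rep.ihom (coeffS S ρN hE hT)).obj (IdeleCohomology.classModUnitsRep K E.1 S)).hV2
  refine LinearMap.ext fun x => ofClassModUnitsS_injective S hE ?_
  rw [ihomLayerEquivS_apply, ofClassModUnitsS_toCoeffHomS_apply, LinearMap.comp_apply, LinearMap.comp_apply,
    ← map_inv (restrictHomS S hE) g, coeffRepS_restrictHomS, ← classBarSRep_ρ_ofClassModUnitsS S hE g, ihomLayerEquivS_apply,
    ofClassModUnitsS_toCoeffHomS_apply]
  rfl

/-- **The layers of `Hom(N, C̄_S)` have the cohomology of `Hom(N_E, C_S(E))`: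
`Hⁿ(G_S ⧸ V̄_E, (Hom(N, C̄_S))^{V̄_E}) ≅ Hⁿ(Gal(E/K), Hom(N_E, C_S(E)))`** (Mathlib `groupCohomology.mapIso` along w3's
`quotLayerSEquiv` and `ihomLayerEquivS`; the equivariance is proved in place).
[cite: MilneADT2006, I Lemma 1.9][cite: SerreGaloisCohomology1997, I §2.2 Proposition 8] -/
def ihomLayerCohomologyIsoS (n : ℕ) :
    groupCohomology (ihomLayerRepS S ρN hρN E) n ≅
      groupCohomology (haveI := E.numberField;
        (Rep.ihom (coeffS S ρN hE hT)).obj (IdeleCohomology.classModUnitsRep K E.1 S)) n :=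
  haveI := E.numberField
  groupCohomology.mapIso (A := (Rep.ihom (coeffS S ρN hE hT)).obj (IdeleCohomology.classModUnitsRep K E.1 S))
    (B := ihomLayerRepS S ρN hρN E) (quotLayerSEquiv S hE) (ihomLayerEquivS S ρN hρN hE hT)
    (fun q => QuotientGroup.induction_on q fun g => DFunLike.ext _ _ fun Φ => by
      exact ihomLayerEquivS_ρ_mk S ρN hρN hE hT g Φ)
    n

end IhomLayer

/-! ## §4. The transitions are `F ↦ Inf_{M/E} ∘ F` -/

section Transitions

variable {V : Type} [AddCommGroup V]
  (ρN : Representation ℤ (GaloisGroupUnramifiedOutside K (↑S : Set (HeightOneSpectrum (𝓞 K)))) V)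
  (hρN : DiscreteRep.IsDiscrete (Rep.of ρN)) [Module.Finite ℤ V]
  {E M : GalLayer K} (h : E ≤ M)
  (hE : ramificationSubgroup K (↑S : Set (HeightOneSpectrum (𝓞 K))) ≤ galFixing K E.1)
  (hM : ramificationSubgroup K (↑S : Set (HeightOneSpectrum (𝓞 K))) ≤ galFixing K M.1)
  (hTE : TrivialOnS S ρN E) (hTM : TrivialOnS S ρN M)

omit hρN [Module.Finite ℤ V] in
/-- The identity of `V` intertwines `coeffRepS` at `M` with `coeffRepS` at `E ≤ M` through `res`. [cite: MilneADT2006, I Lemma 1.9] -/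
theorem coeffS_refl_comm (τ : M.1 ≃ₐ[K] M.1) (x : V) :
    (LinearEquiv.refl ℤ V) ((coeffS S ρN hM hTM).ρ τ x) =
      (coeffS S ρN hE hTE).ρ (GalLayer.resHom h τ) ((LinearEquiv.refl ℤ V) x) := by
  rw [LinearEquiv.refl_apply, LinearEquiv.refl_apply]
  exact congrArg (fun ρ => ρ x) (coeffRepS_resHom S ρN hE h hM hTE hTM τ).symm

/-- **The transition `Hom(N_E, C_S(E)) → Hom(N_M, C_S(M))`, `F ↦ Inf_{M/E} ∘ F`** (`Inf_{M/E}` = bsd-line-x1-p1-w4's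
`classModUnitsInflHom K E M S`), as the morphism `Res_{res} Hom(N_E, C_S(E)) ⟶ Hom(N_M, C_S(M))` (door-c6's `ihomTransition` with
`e = id`). [cite: Harari2020, §16.2 Definition 16.11][cite: NeukirchSchmidtWingberg2008, VIII §3 (8.3.9)] -/
abbrev ihomBaseRepHomS :
    haveI := E.numberField; haveI := M.numberField;
    Rep.res (GalLayer.resHom h) ((Rep.ihom (coeffS S ρN hE hTE)).obj (IdeleCohomology.classModUnitsRep K E.1 S)) ⟶
      (Rep.ihom (coeffS S ρN hM hTM)).obj (IdeleCohomology.classModUnitsRep K M.1 S) :=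
  haveI := E.numberField
  haveI := M.numberField
  haveI := E.isGalois
  letI := GalLayer.algebraOfLE h
  haveI := GalLayer.isScalarTower_of_le h
  ihomTransition (GalLayer.resHom h) (IdeleCohomology.classModUnitsRep K E.1 S) (coeffS S ρN hE hTE)
    (IdeleCohomology.classModUnitsRep K M.1 S) (coeffS S ρN hM hTM) (IdeleCohomology.classModUnitsInflHom K E.1 M.1 S)
    (LinearEquiv.refl ℤ V) (coeffS_refl_comm S ρN h hE hM hTE hTM)

/-- **The inflation `Hⁿ(Gal(E/K), Hom(N_E, C_S(E))) → Hⁿ(Gal(M/K), Hom(N_M, C_S(M)))`** along `(res, F ↦ Inf ∘ F)`.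
[cite: MilneADT2006, I Lemma 1.9] -/
def ihomInfS (n : ℕ) :
    groupCohomology (haveI := E.numberField;
        (Rep.ihom (coeffS S ρN hE hTE)).obj (IdeleCohomology.classModUnitsRep K E.1 S)) n ⟶
      groupCohomology (haveI := M.numberField;
        (Rep.ihom (coeffS S ρN hM hTM)).obj (IdeleCohomology.classModUnitsRep K M.1 S)) n :=
  haveI := E.numberField
  haveI := M.numberField
  groupCohomology.map (GalLayer.resHom h) (ihomBaseRepHomS S ρN h hE hM hTE hTM) n

/-- **The inclusion `(Hom(N, C̄_S))^{V̄_E} ⊆ (Hom(N, C̄_S))^{V̄_M}` is `F ↦ Inf ∘ F`** under the `ihomLayerEquivS`s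
(`ofClassModUnitsS_M (Inf y) = ofClassModUnitsS_E y`: both are `[x]` for `y = π x`, w3's `ofLayerS_transHom`).
[cite: MilneADT2006, I Lemma 1.9][cite: NeukirchSchmidtWingberg2008, VIII §3 (8.3.9)] -/
theorem ofClassModUnitsS_classModUnitsInflHom (y : haveI := E.numberField; (IdeleCohomology.classModUnitsRep K E.1 S).V) :
    ofClassModUnitsS S hM (haveI := E.numberField; haveI := M.numberField; haveI := E.isGalois; letI := GalLayer.algebraOfLE h;
        (IdeleCohomology.classModUnitsInflHom K E.1 M.1 S).hom y) = ofClassModUnitsS S hE y := by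
  haveI := E.numberField
  haveI := M.numberField
  haveI := E.isGalois
  letI := GalLayer.algebraOfLE h
  haveI := GalLayer.isScalarTower_of_le h
  have hy := RepCokernel.hom_π_surjective (IdeleCohomology.unitsOffToClass (F := K) (E := E.1) S) y
  obtain ⟨x, rfl⟩ := hy
  rw [← π_transHom_eq_classModUnitsInflHom S h, ofClassModUnitsS_π, ofClassModUnitsS_π, ofLayerS_transHom S h hE hM]

/-- `invariantsStepIncl` read through the `ihomLayerEquivS`s is `F ↦ Inf ∘ F`. [cite: MilneADT2006, I Lemma 1.9] -/
theorem ihomLayerEquivS_invariantsStepIncl (Φ : (ihomLayerRepS S ρN hρN E).V) :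
    haveI := E.numberField; haveI := M.numberField;
    ihomLayerEquivS S ρN hρN hM hTM ((DiscreteRep.invariantsStepIncl
        (layerSubgroupS S E : Subgroup (GaloisGroupUnramifiedOutside K (↑S : Set (HeightOneSpectrum (𝓞 K)))))
        (layerSubgroupS S M : Subgroup (GaloisGroupUnramifiedOutside K (↑S : Set (HeightOneSpectrum (𝓞 K)))))
        (layerSubgroupS_anti S h) (DiscreteRep.ihomObj (latticeDS S ρN hρN) (classBarSD K S))).hom Φ) =
      (ihomBaseRepHomS S ρN h hE hM hTE hTM).hom (ihomLayerEquivS S ρN hρN hE hTE Φ) := by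
  haveI := E.numberField
  haveI := M.numberField
  haveI := E.isGalois
  letI := GalLayer.algebraOfLE h
  haveI := GalLayer.isScalarTower_of_le h
  letI := (IdeleCohomology.classModUnitsRep K E.1 S).hV2
  letI := (IdeleCohomology.classModUnitsRep K M.1 S).hV2
  refine LinearMap.ext fun x => ofClassModUnitsS_injective S hM ?_
  change ofClassModUnitsS S hM (toCoeffHomS S ρN hρN hM hTM ((DiscreteRep.invariantsStepIncl
        (layerSubgroupS S E : Subgroup (GaloisGroupUnramifiedOutside K (↑S : Set (HeightOneSpectrum (𝓞 K)))))
        (layerSubgroupS S M : Subgroup (GaloisGroupUnramifiedOutside K (↑S : Set (HeightOneSpectrum (𝓞 K)))))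
        (layerSubgroupS_anti S h) (DiscreteRep.ihomObj (latticeDS S ρN hρN) (classBarSD K S))).hom Φ) x) =
    ofClassModUnitsS S hM ((IdeleCohomology.classModUnitsInflHom K E.1 M.1 S).hom (toCoeffHomS S ρN hρN hE hTE Φ x))
  rw [ofClassModUnitsS_toCoeffHomS_apply, ofClassModUnitsS_classModUnitsInflHom S h hE hM, ofClassModUnitsS_toCoeffHomS_apply]
  rfl

/-- `quotMap ∘ (quotLayerSEquiv_M)⁻¹ = (quotLayerSEquiv_E)⁻¹ ∘ res` on `Gal(M/K)` (both send `σ|_M` to `[[σ]] ∈ G_S ⧸ V̄_E`).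
[cite: SerreGaloisCohomology1997, I §2.2 Proposition 8] -/
theorem quotMap_comp_quotLayerSEquiv_symm_eq_comp_resHom :
    (DiscreteRep.quotMap
          (layerSubgroupS S E : Subgroup (GaloisGroupUnramifiedOutside K (↑S : Set (HeightOneSpectrum (𝓞 K)))))
          (layerSubgroupS S M : Subgroup (GaloisGroupUnramifiedOutside K (↑S : Set (HeightOneSpectrum (𝓞 K)))))
          (layerSubgroupS_anti S h)).comp (quotLayerSEquiv S hM).symm.toMonoidHom =
      (quotLayerSEquiv S hE).symm.toMonoidHom.comp (GalLayer.resHom h) := by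
  refine MonoidHom.ext fun τ => ?_
  have hτ := ((quotLayerSEquiv S hM).surjective.comp (QuotientGroup.mk'_surjective _)) τ
  obtain ⟨g, rfl⟩ := hτ
  change DiscreteRep.quotMap
        (layerSubgroupS S E : Subgroup (GaloisGroupUnramifiedOutside K (↑S : Set (HeightOneSpectrum (𝓞 K)))))
        (layerSubgroupS S M : Subgroup (GaloisGroupUnramifiedOutside K (↑S : Set (HeightOneSpectrum (𝓞 K)))))
        (layerSubgroupS_anti S h) ((quotLayerSEquiv S hM).symm (restrictHomS S hM g)) =
      (quotLayerSEquiv S hE).symm (GalLayer.resHom h (restrictHomS S hM g))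
  have h1 : (quotLayerSEquiv S hM).symm (restrictHomS S hM g) = QuotientGroup.mk g := (MulEquiv.symm_apply_eq _).2 rfl
  have h2 : (quotLayerSEquiv S hE).symm (restrictHomS S hE g) = QuotientGroup.mk g := (MulEquiv.symm_apply_eq _).2 rfl
  rw [h1, resHom_restrictHomS S h hE hM, h2, DiscreteRep.quotMap_mk]

set_option maxHeartbeats 1600000 in
-- as in door-c6's `GalLayerData.stepG_comp_ihomLayerCohomologyIso`: two `groupCohomology.map` composites compared through `map_comp` /
-- `map_congr'`; the `ℤ`-instance paths of the `Hom`-layer objects are what needs the heartbeats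
/-- **`stepG ≫ iso_M = iso_E ≫ ihomInfS` for `E ≤ M`**: door-c4's transition between the layers of `Hom(N, C̄_S)` IS the inflation
`F ↦ Inf ∘ F` of the `Hom`-system (both are `groupCohomology.map` along the same homomorphism `Gal(M/K) → G_S ⧸ V̄_E` with the same
underlying map). [cite: MilneADT2006, I Lemma 1.9][cite: SerreGaloisCohomology1997, I §2.2 Proposition 8] -/
theorem stepG_comp_ihomLayerCohomologyIsoS (n : ℕ) :
    DiscreteRep.LayerColimit.stepG (layerSubgroupS S E) (layerSubgroupS S M) (layerSubgroupS_anti S h)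
        (DiscreteRep.ihomObj (latticeDS S ρN hρN) (classBarSD K S)) n ≫ (ihomLayerCohomologyIsoS S ρN hρN hM hTM n).hom =
      (ihomLayerCohomologyIsoS S ρN hρN hE hTE n).hom ≫ ihomInfS S ρN h hE hM hTE hTM n := by
  haveI := E.numberField
  haveI := M.numberField
  rw [ihomLayerCohomologyIsoS, ihomLayerCohomologyIsoS, groupCohomology.mapIso_hom, groupCohomology.mapIso_hom,
    ihomInfS, ← groupCohomology.map_comp, ← groupCohomology.map_comp]
  refine Literature.Algebra.Homology.map_congr' (quotMap_comp_quotLayerSEquiv_symm_eq_comp_resHom S h hE hM) _ _ (fun Φ => ?_) n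
  exact ihomLayerEquivS_invariantsStepIncl S ρN hρN h hE hM hTE hTM Φ

/-- Elementwise form: `iso_M (stepG c) = ihomInfS (iso_E c)`. [cite: MilneADT2006, I Lemma 1.9] -/
theorem ihomLayerCohomologyIsoS_stepG (n : ℕ) (c : groupCohomology (ihomLayerRepS S ρN hρN E) n) :
    (ihomLayerCohomologyIsoS S ρN hρN hM hTM n).hom (DiscreteRep.LayerColimit.stepG (layerSubgroupS S E)
        (layerSubgroupS S M) (layerSubgroupS_anti S h) (DiscreteRep.ihomObj (latticeDS S ρN hρN) (classBarSD K S)) n c) =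
      ihomInfS S ρN h hE hM hTE hTM n ((ihomLayerCohomologyIsoS S ρN hρN hE hTE n).hom c) := by
  rw [← CategoryTheory.comp_apply, ← CategoryTheory.comp_apply, stepG_comp_ihomLayerCohomologyIsoS]

end Transitions

end IdeleClassBar

end Literature.NumberTheory.GaloisRepresentations

end
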